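import Summits.ResolutionOfSingularities.ResolutionOfSingularities.Theorems.CurveBranchRoot45
import Summits.ResolutionOfSingularities.ResolutionOfSingularities.Theorems.AbsoluteRider
import Summits.ResolutionOfSingularities.ResolutionOfSingularities.Theorems.PolygonLawKernel
import Summits.ResolutionOfSingularities.ResolutionOfSingularities.Theorems.RestrictCutPort
import HarnessLib

/-!
# PrincipalAxisCut — decomp-res lens-5 g41 node «PrincipalAxisCut» (lens: finite/base range + asymptotic regime + bridge)

OURS (D-0178 root decomposition cell, residual mode; HOME = run/shared/lean/pub/decomp-res; CLAIM line on STATUS.md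
2026-09-01T00:06:45Z for the free doors hPu + hR + hRi of the g45 root `noForcedTowers_of_g45`).

THE BRIDGE.  The PRINCIPAL AXIS of the lens-4 weight-descent column (g16–g20: `HugShadow.Principal`, «the hugged surface
germ is a hypersurface at the hugging point») IS THE RING-DIMENSION AXIS read on the hug: a principal hug shadow of a forced
tower of weight `n ≥ 1` over an `IsBase` root lives in ring dimension THREE at its hugging stage (tree, lens-4 g34:
`HugShadow.ringKrullDim_eq_three`, `dim 𝒪 = dim 𝒪/(g) + 1 = 2 + 1`), the ring dimension of the marked local rings is
CONSTANT along a forced tower (tree, lens-4 g34: `tower_ringKrullDim_pt_eq`), hence such a tower is a `ThreefoldTower`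
at EVERY stage (`HugShadow.threefoldTower_of_principal`, this file) — and the base range `d = 3` is DECIDED in the kernel
by the landed POLYGON LAW D (tree, lens-4 g43: `noTower_threefoldTower`, Cossart–Jannsen–Saito's measure `(β, e)` /
Cossart–Piltant Prop. 4.4, `τ = 1` and `τ = 2`).  Consequently EVERY tower class and EVERY port of the column whose
letters contain a POSITIVE principal-shadow clause (`∃ S : HugShadow T, S.Principal ∧ …`, resp. a binder
`… → S.Principal → …`) is EMPTY, resp. VACUOUSLY TRUE — for every prime `p`, every field, every weight, perfect or not,
pure or impure, isolated or drifting, tame or wild, commensurable or not.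

CONTENT.  §1 the bridge and the class-free law `noTower_of_principal`; §2 the zero-binder laws VERBATIM for the column's
principal cells and ports: `purePrincipalTowersTerminate_holds` … `riderPort_holds`, and over all weights
`noPurePrincipalTowers_holds : NoPurePrincipalTowers` (root binder hPu), `noIncommensurableWildDriftingImperfectTowers_holds`
(root binder hR), `riderPortAll_holds : RiderPortAll` (root binder hRi), together with `noDriftingTowers_holds`,
`noWildDriftingTowers_holds`, `noCommensurableImpureTowers_holds`, `noIncommensurableWildDriftingTowers_holds`,
`noRecurrentIncommensurableWildDriftingTowers_holds`,
`noFactorIsolatedTowers_holds`, `noImpurePrincipalTowers_holds`, `absRiderPortAll_holds`, `imperfectRiderPortAll_holds`,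
`noIncommensurableWildDriftingPerfectTowers_holds`, `noRecurrentIncommensurableWildDriftingImperfectTowers_holds`; §3 the
MaxContactCut asides BY NAME (items 27718, 27719, 27722, 27725, 27726, 27728, 27790, 27791; the ports `DescentPortAll` 27720 and
`CouplingPortAll` 27727 were discharged EARLIER by lens-4's «DescentMap» / «CouplingMap» by genuine descent — not restated); §4 the ROOT:
30253 `MaxContactCut.NoForcedTowers` from g45's thirteen binders MINUS EXACTLY hPu, hR, hRi (ten binders,
`noForcedTowers_of_g47`), its residual form (nine), and the g45 root RECOVERED from it.

HONESTY.  No new mathematics beyond composition: the three ingredients are lens-4's landed theorems named above; lens-5's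
contribution is the observation that the column's principal letter is a dimension letter, so that the g43 polygon law
empties the whole principal sub-column, and the by-name sweep.  NOT proved here: `MaxContactCut.NoForcedTowers`
(binders `hMo hSL hH hP hM h71 hB hC4 hD4 hNP` remain — all of them live in ring dimension FOUR or are structural ports),
nor resolution of singularities in any dimension `≥ 4`.  AI-written; no named facts, no ports, no sorry.
-/

noncomputable section

set_option linter.dupNamespace false

open CategoryTheory CategoryTheory.Limits AlgebraicGeometry TopologicalSpace IsLocalRing
open Literature.AlgebraicGeometry.Resolution
open Summit.ResolutionOfSingularities.ResolutionOfSingularities.Theorems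
open WeakOrderReduction ForcedTowerClasses DivergentTowerClasses MonomialTowerClasses
open HugDimensionClasses HugDimensionKernels SurfaceShadowClasses SurfaceShadowKernels
open ContactShadowClasses (NoTowerImperfect)
open ContactShadowKernels (noTowerImperfect_of_noTower)
open NearPointCut (SingularClass)

namespace Summit.ResolutionOfSingularities.ResolutionOfSingularities.Theorems.HugValuationCut

section PrincipalAxis

variable {k : Type} [Field k]

/-! ## §1 THE BRIDGE: a principal hug shadow makes the tower a threefold tower; the class-free law -/

/-- **BRIDGE (KERNEL).**  A forced tower of weight `n ≥ 1` over an `IsBase` root with a PRINCIPAL hug shadow is a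
`ThreefoldTower`: ring dimension exactly `3` at every marked point (`dim 𝒪_{x_m} = 3` by `HugShadow.ringKrullDim_eq_three`,
constancy by `tower_ringKrullDim_pt_eq`). [folklore] -/
theorem HugShadow.threefoldTower_of_principal {T : ForcedTower} (S : HugShadow T) (g : T.St 0 ⟶ Spec (.of k))
    (hB : IsBase (T.St 0) g) {n : ℕ} (hD : IsDatum n (T.D 0)) (hn : 1 ≤ n) (hP : S.Principal) : ThreefoldTower T := by
  have h3 := S.ringKrullDim_eq_three g hB hP
  intro i
  unfold DimThreeAt DimFourAt
  rw [tower_ringKrullDim_pt_eq T g hB hD hn i, ← tower_ringKrullDim_pt_eq T g hB hD hn S.m, h3]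
  exact ⟨le_rfl, by decide⟩

/-- **THE CLASS-FREE LAW (KERNEL): no forced tower of weight `n ≥ 1` in ANY class that yields a principal hug shadow**
(bridge + the landed polygon LAW D `noTower_threefoldTower`). [folklore] -/
theorem noTower_of_principal {n : ℕ} (hn : 1 ≤ n) (P : ForcedTower → Prop)
    (hP : ∀ T, P T → ∃ S : HugShadow T, S.Principal) : NoTower n P := by
  intro p hp K _ _ T g hB hD hE hT
  obtain ⟨S, hS⟩ := hP T hT
  exact noTower_threefoldTower hn p hp K T g hB hD hE (S.threefoldTower_of_principal g hB hD hn hS)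

/-- the same on the PERFECT column. [folklore] -/
theorem noTowerPerfect_of_principal {n : ℕ} (hn : 1 ≤ n) (P : ForcedTower → Prop)
    (hP : ∀ T, P T → ∃ S : HugShadow T, S.Principal) : NoTowerPerfect n P :=
  noTowerPerfect_of_noTower (noTower_of_principal hn P hP)

/-- the same on the IMPERFECT column. [folklore] -/
theorem noTowerImperfect_of_principal {n : ℕ} (hn : 1 ≤ n) (P : ForcedTower → Prop)
    (hP : ∀ T, P T → ∃ S : HugShadow T, S.Principal) : NoTowerImperfect n P :=
  noTowerImperfect_of_noTower (noTower_of_principal hn P hP)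

/-- **PORT SHAPE (KERNEL)**: under the binders of a forced tower of weight `n ≥ 1` over an `IsBase` root, a principal hug
shadow is CONTRADICTORY — every port quantifying `… → S.Principal → …` is vacuously true. [folklore] -/
theorem false_of_principal {p : ℕ} (hp : p.Prime) {K : Type} [Field K] [CharP K p] {T : ForcedTower}
    {g : T.St 0 ⟶ Spec (.of K)} (hB : IsBase (T.St 0) g) {n : ℕ} (hn : 1 ≤ n) (hD : IsDatum n (T.D 0))
    (hE : (T.D 0).boundary = []) (S : HugShadow T) (hP : S.Principal) : False :=
  noTower_threefoldTower hn p hp K T g hB hD hE (S.threefoldTower_of_principal g hB hD hn hP)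

/-! ## §2 THE ZERO-BINDER LAWS of the principal sub-column, VERBATIM (every cell / port with a positive principal clause) -/

/-- (L,P,pure) — g16's cell, hitherto DECIDED-MOD-PORT (CJS Thm. 6.40). [folklore] -/
theorem purePrincipalTowersTerminate_holds {n : ℕ} (hn : 1 ≤ n) : PurePrincipalTowersTerminate n :=
  noTower_of_principal hn _ fun _ h => by obtain ⟨-, -, S, hS, -⟩ := h; exact ⟨S, hS⟩

/-- (L,P,factor-isolated). [folklore] -/
theorem factorIsolatedTowersTerminate_holds {n : ℕ} (hn : 1 ≤ n) : FactorIsolatedTowersTerminate n :=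
  noTower_of_principal hn _ fun _ h => by obtain ⟨-, -, S, hS, -⟩ := h; exact ⟨S, hS⟩

/-- (L,P,impure,top-isolated). [folklore] -/
theorem topIsolatedImpureTowersTerminate_holds {n : ℕ} (hn : 1 ≤ n) : TopIsolatedImpureTowersTerminate n :=
  noTower_of_principal hn _ fun _ h => by obtain ⟨-, -, S, hS, -⟩ := h; exact ⟨S, hS⟩

/-- (L,P,impure,tail-isolated). [folklore] -/
theorem tailIsolatedImpureTowersTerminate_holds {n : ℕ} (hn : 1 ≤ n) : TailIsolatedImpureTowersTerminate n :=
  noTower_of_principal hn _ fun _ h => by obtain ⟨-, -, S, hS, -⟩ := h; exact ⟨S, hS⟩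

/-- (L,P,drifting) — g16's LOCATED RESIDUAL. [folklore] -/
theorem driftingTowersTerminate_holds {n : ℕ} (hn : 1 ≤ n) : DriftingTowersTerminate n :=
  noTower_of_principal hn _ fun _ h => by obtain ⟨-, -, S, hS, -⟩ := h; exact ⟨S, hS⟩

/-- the whole principal in-locus column. [folklore] -/
theorem principalInLocusTowersTerminate_holds {n : ℕ} (hn : 1 ≤ n) : PrincipalInLocusTowersTerminate n :=
  noTower_of_principal hn _ fun _ h => h.2.2

/-- (L,P,drift,wild) — g17's LOCATED RESIDUAL. [folklore] -/
theorem wildDriftingTowersTerminate_holds {n : ℕ} (hn : 1 ≤ n) : WildDriftingTowersTerminate n :=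
  noTower_of_principal hn _ fun _ h => by obtain ⟨-, -, S, hS, -⟩ := h; exact ⟨S, hS⟩

/-- the tame impure slab. [folklore] -/
theorem tameImpureTowersTerminate_holds {n : ℕ} (hn : 1 ≤ n) : TameImpureTowersTerminate n :=
  noTower_of_principal hn _ fun _ h => by obtain ⟨-, -, S, hS, -⟩ := h; exact ⟨S, hS⟩

/-- the wild impure slab. [folklore] -/
theorem wildImpureTowersTerminate_holds {n : ℕ} (hn : 1 ≤ n) : WildImpureTowersTerminate n :=
  noTower_of_principal hn _ fun _ h => by obtain ⟨-, -, S, hS, -⟩ := h; exact ⟨S, hS⟩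

/-- the commensurable impure slab. [folklore] -/
theorem commensurableImpureTowersTerminate_holds {n : ℕ} (hn : 1 ≤ n) : CommensurableImpureTowersTerminate n :=
  noTower_of_principal hn _ fun _ h => by obtain ⟨-, -, S, hS, -⟩ := h; exact ⟨S, hS⟩

/-- the incommensurable impure slab. [folklore] -/
theorem incommensurableImpureTowersTerminate_holds {n : ℕ} (hn : 1 ≤ n) : IncommensurableImpureTowersTerminate n :=
  noTower_of_principal hn _ fun _ h => by obtain ⟨-, -, S, hS, -⟩ := h; exact ⟨S, hS⟩

/-- (L,P,drift,wild,commensurable). [folklore] -/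
theorem commensurableWildDriftingTowersTerminate_holds {n : ℕ} (hn : 1 ≤ n) :
    CommensurableWildDriftingTowersTerminate n :=
  noTower_of_principal hn _ fun _ h => by obtain ⟨-, -, S, hS, -⟩ := h; exact ⟨S, hS⟩

/-- (L,P,drift,wild,incommensurable) — g18's LOCATED RESIDUAL. [folklore] -/
theorem incommensurableWildDriftingTowersTerminate_holds {n : ℕ} (hn : 1 ≤ n) :
    IncommensurableWildDriftingTowersTerminate n :=
  noTower_of_principal hn _ fun _ h => by obtain ⟨-, -, S, hS, -⟩ := h; exact ⟨S, hS⟩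

/-- (L,P,drift,wild,incomm, eventually free). [folklore] -/
theorem freeIncommensurableWildDriftingTowersTerminate_holds {n : ℕ} (hn : 1 ≤ n) :
    FreeIncommensurableWildDriftingTowersTerminate n :=
  noTower_of_principal hn _ fun _ h => by obtain ⟨-, -, -, S, hS, -⟩ := h; exact ⟨S, hS⟩

/-- (L,P,drift,wild,incomm, recurrent). [folklore] -/
theorem recurrentIncommensurableWildDriftingTowersTerminate_holds {n : ℕ} (hn : 1 ≤ n) :
    RecurrentIncommensurableWildDriftingTowersTerminate n :=
  noTower_of_principal hn _ fun _ h => by obtain ⟨-, -, -, S, hS, -⟩ := h; exact ⟨S, hS⟩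

/-- the whole impure principal column (g20). [folklore] -/
theorem impurePrincipalTowersTerminate_holds {n : ℕ} (hn : 1 ≤ n) : ImpurePrincipalTowersTerminate n :=
  noTower_of_principal hn _ fun _ h => by obtain ⟨-, -, S, hS, -⟩ := h; exact ⟨S, hS⟩

/-- (L,P,drift,wild,incomm · PERFECT k). [folklore] -/
theorem incommensurableWildDriftingPerfectTowersTerminate_holds {n : ℕ} (hn : 1 ≤ n) :
    IncommensurableWildDriftingPerfectTowersTerminate n :=
  noTowerPerfect_of_principal hn _ fun _ h => by obtain ⟨-, -, S, hS, -⟩ := h; exact ⟨S, hS⟩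

/-- the incommensurable impure slab over perfect fields. [folklore] -/
theorem incommensurableImpurePerfectTowersTerminate_holds {n : ℕ} (hn : 1 ≤ n) :
    IncommensurableImpurePerfectTowersTerminate n :=
  noTowerPerfect_of_principal hn _ fun _ h => by obtain ⟨-, -, S, hS, -⟩ := h; exact ⟨S, hS⟩

/-- the impure principal column over perfect fields. [folklore] -/
theorem impurePrincipalPerfectTowersTerminate_holds {n : ℕ} (hn : 1 ≤ n) :
    ImpurePrincipalPerfectTowersTerminate n :=
  noTowerPerfect_of_principal hn _ fun _ h => by obtain ⟨-, -, S, hS, -⟩ := h; exact ⟨S, hS⟩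

/-- (L,P,drift,wild,incomm · IMPERFECT k) — g19's LOCATED RESIDUAL, the root binder hR at weight `n`. [folklore] -/
theorem incommensurableWildDriftingImperfectTowersTerminate_holds {n : ℕ} (hn : 1 ≤ n) :
    IncommensurableWildDriftingImperfectTowersTerminate n :=
  noTowerImperfect_of_principal hn _ fun _ h => by obtain ⟨-, -, S, hS, -⟩ := h; exact ⟨S, hS⟩

/-- (… · IMPERFECT k · eventually free). [folklore] -/
theorem freeIncommensurableWildDriftingImperfectTowersTerminate_holds {n : ℕ} (hn : 1 ≤ n) :
    FreeIncommensurableWildDriftingImperfectTowersTerminate n :=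
  noTowerImperfect_of_principal hn _ fun _ h => by obtain ⟨-, -, -, S, hS, -⟩ := h; exact ⟨S, hS⟩

/-- (… · IMPERFECT k · recurrent) — g19's located residual after the rider. [folklore] -/
theorem recurrentIncommensurableWildDriftingImperfectTowersTerminate_holds {n : ℕ} (hn : 1 ≤ n) :
    RecurrentIncommensurableWildDriftingImperfectTowersTerminate n :=
  noTowerImperfect_of_principal hn _ fun _ h => by obtain ⟨-, -, -, S, hS, -⟩ := h; exact ⟨S, hS⟩

/-- **PORT `RiderPort n` HOLDS (vacuously)** — the root binder hRi at weight `n`. [folklore] -/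
theorem riderPort_holds {n : ℕ} (hn : 1 ≤ n) : RiderPort n :=
  fun _ hp _ _ _ _ _ _ hB hD hE _ S _ hP _ => (false_of_principal hp hB hn hD hE S hP).elim

/-- **PORT `AbsRiderPort n` HOLDS (vacuously).** [folklore] -/
theorem absRiderPort_holds {n : ℕ} (hn : 1 ≤ n) : AbsRiderPort n :=
  fun _ hp _ _ _ _ _ hB hD hE _ S _ hP _ => (false_of_principal hp hB hn hD hE S hP).elim

/-- **PORT `ImperfectRiderPort n` HOLDS (vacuously).** [folklore] -/
theorem imperfectRiderPort_holds {n : ℕ} (hn : 1 ≤ n) : ImperfectRiderPort n :=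
  fun _ hp _ _ _ _ _ _ hB hD hE _ S _ hP _ => (false_of_principal hp hB hn hD hE S hP).elim

/-! ### over all weights (the registered all-weights names, VERBATIM, zero binders) -/

/-- **hPu — `NoPurePrincipalTowers` HOLDS** (root binder of `noForcedTowers_of_g45`; MaxContactCut item 27718). [folklore] -/
theorem noPurePrincipalTowers_holds : NoPurePrincipalTowers := fun _ hn => purePrincipalTowersTerminate_holds hn

/-- **hR — `NoIncommensurableWildDriftingImperfectTowers` HOLDS** (root binder; item 27790). [folklore] -/
theorem noIncommensurableWildDriftingImperfectTowers_holds : NoIncommensurableWildDriftingImperfectTowers :=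
  fun _ hn => incommensurableWildDriftingImperfectTowersTerminate_holds hn

/-- **hRi — `RiderPortAll` HOLDS** (root binder; item 27791). [folklore] -/
theorem riderPortAll_holds : RiderPortAll := fun _ hn => riderPort_holds hn

/-- `NoDriftingTowers` (item 27719). [folklore] -/
theorem noDriftingTowers_holds : NoDriftingTowers := fun _ hn => driftingTowersTerminate_holds hn

/-- `NoWildDriftingTowers` (item 27722). [folklore] -/
theorem noWildDriftingTowers_holds : NoWildDriftingTowers := fun _ hn => wildDriftingTowersTerminate_holds hn

/-- `NoCommensurableImpureTowers` (item 27725). [folklore] -/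
theorem noCommensurableImpureTowers_holds : NoCommensurableImpureTowers :=
  fun _ hn => commensurableImpureTowersTerminate_holds hn

/-- `NoIncommensurableWildDriftingTowers` (item 27726). [folklore] -/
theorem noIncommensurableWildDriftingTowers_holds : NoIncommensurableWildDriftingTowers :=
  fun _ hn => incommensurableWildDriftingTowersTerminate_holds hn

/-- `NoRecurrentIncommensurableWildDriftingTowers` (item 27728). [folklore] -/
theorem noRecurrentIncommensurableWildDriftingTowers_holds : NoRecurrentIncommensurableWildDriftingTowers :=
  fun _ hn => recurrentIncommensurableWildDriftingTowersTerminate_holds hn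

/-- `NoFactorIsolatedTowers`. [folklore] -/
theorem noFactorIsolatedTowers_holds : NoFactorIsolatedTowers := fun _ hn => factorIsolatedTowersTerminate_holds hn

/-- `NoImpurePrincipalTowers` (g20). [folklore] -/
theorem noImpurePrincipalTowers_holds : NoImpurePrincipalTowers := fun _ hn => impurePrincipalTowersTerminate_holds hn

/-- `AbsRiderPortAll` (g20's absolute port). [folklore] -/
theorem absRiderPortAll_holds : AbsRiderPortAll := fun _ hn => absRiderPort_holds hn

/-- `ImperfectRiderPortAll` (g20). [folklore] -/
theorem imperfectRiderPortAll_holds : ImperfectRiderPortAll := fun _ hn => imperfectRiderPort_holds hn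

/-- `NoIncommensurableWildDriftingPerfectTowers` (g19's decided half, now port-free). [folklore] -/
theorem noIncommensurableWildDriftingPerfectTowers_holds : NoIncommensurableWildDriftingPerfectTowers :=
  fun _ hn => incommensurableWildDriftingPerfectTowersTerminate_holds hn

/-- `NoRecurrentIncommensurableWildDriftingImperfectTowers` (g19's residual after the rider). [folklore] -/
theorem noRecurrentIncommensurableWildDriftingImperfectTowers_holds :
    NoRecurrentIncommensurableWildDriftingImperfectTowers :=
  fun _ hn => recurrentIncommensurableWildDriftingImperfectTowersTerminate_holds hn

end PrincipalAxis

/-! ## §3 The MaxContactCut asides BY NAME (route `route-ResolutionOfSingularities-MaxContactCut`) -/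

section ByName

open Summit.ResolutionOfSingularities.ResolutionOfSingularities.Theses

/-- item 27718 `MaxContactCut.WDNoPurePrincipalTowers`. [folklore] -/
theorem wdNoPurePrincipalTowers_holds : MaxContactCut.WDNoPurePrincipalTowers := noPurePrincipalTowers_holds

/-- item 27719 `MaxContactCut.WDNoDriftingTowers`. [folklore] -/
theorem wdNoDriftingTowers_holds : MaxContactCut.WDNoDriftingTowers := noDriftingTowers_holds

/-- item 27722 `MaxContactCut.FCNoWildDriftingTowers`. [folklore] -/
theorem fcNoWildDriftingTowers_holds : MaxContactCut.FCNoWildDriftingTowers := noWildDriftingTowers_holds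

/-- item 27725 `MaxContactCut.CCNoCommensurableImpureTowers`. [folklore] -/
theorem ccNoCommensurableImpureTowers_holds : MaxContactCut.CCNoCommensurableImpureTowers :=
  noCommensurableImpureTowers_holds

/-- item 27726 `MaxContactCut.CCNoIncommensurableWildDriftingTowers`. [folklore] -/
theorem ccNoIncommensurableWildDriftingTowers_holds : MaxContactCut.CCNoIncommensurableWildDriftingTowers :=
  noIncommensurableWildDriftingTowers_holds

/-- item 27728 `MaxContactCut.CCNoRecurrentIncommensurableWildDriftingTowers`. [folklore] -/
theorem ccNoRecurrentIncommensurableWildDriftingTowers_holds :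
    MaxContactCut.CCNoRecurrentIncommensurableWildDriftingTowers :=
  noRecurrentIncommensurableWildDriftingTowers_holds

/-- item 27790 `MaxContactCut.RCNoIncommensurableWildDriftingImperfectTowers`. [folklore] -/
theorem rcNoIncommensurableWildDriftingImperfectTowers_holds :
    MaxContactCut.RCNoIncommensurableWildDriftingImperfectTowers :=
  noIncommensurableWildDriftingImperfectTowers_holds

/-- item 27791 `MaxContactCut.RCRiderPortAll`. [folklore] -/
theorem rcRiderPortAll_holds : MaxContactCut.RCRiderPortAll := riderPortAll_holds

end ByName

/-! ## §4 THE ROOT: 30253 `MaxContactCut.NoForcedTowers` from g45's binders MINUS EXACTLY hPu, hR, hRi (13 → 10) -/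

section Root

open Summit.ResolutionOfSingularities.ResolutionOfSingularities.Theses

/-- **the weight-`n` step from the g47 cells**: g45's `ftt_step_of_g45` with `hRi`, `hPu`, `hR` DISCHARGED. [folklore] -/
theorem ftt_step_of_g47 {n : ℕ} (hn : 1 ≤ n) (hMo : MonomialCorner n) (hSL : SurfaceLaw n)
    (hH : HypersurfaceHuggingTowersTerminate n) (hP : ShadowPort n) (hM : MarkingPort n)
    (h71 : ContactHuggingTowersTerminate n)
    (hB : WildLatentFactorNonThreefoldMixedWallFreeFreshJumpShallowCompanionKangarooTowersTerminate n)
    (hC4 : WildOccultDivisorialNonThreefoldMixedWallFreeFreshJumpShallowCompanionKangarooTowersTerminate n)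
    (hD4 : WildOccultNonDivisorialNonThreefoldMixedWallFreeFreshJumpShallowCompanionKangarooTowersTerminate n)
    (hNP : ContactFreeNonPrincipalInLocusTowersTerminate n)
    (hlow : ∀ n' : ℕ, 1 ≤ n' → n' < n → ForcedTowersTerminate n') : ForcedTowersTerminate n :=
  ftt_step_of_g45 hn hMo hSL hH hP hM (riderPort_holds hn) h71 hB hC4 hD4 hNP (purePrincipalTowersTerminate_holds hn)
    (incommensurableWildDriftingImperfectTowersTerminate_holds hn) hlow

/-- **`∀ n ≥ 1, ForcedTowersTerminate n`** from the g47 cells. [folklore] -/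
theorem forcedTowersTerminate_of_g47 (hMo : MaxContactCut.MonomialCornerAll)
    (hSL : MaxContactCut.SurfaceLawAll) (hH : MaxContactCut.NoHypersurfaceHuggingTowers) (hP : ShadowPortAll)
    (hM : MarkingPortAll) (h71 : MaxContactCut.NoContactHuggingTowers)
    (hB : NoWildLatentFactorNonThreefoldMixedTowers)
    (hC4 : NoWildOccultDivisorialNonThreefoldMixedTowers) (hD4 : NoWildOccultNonDivisorialNonThreefoldMixedTowers)
    (hNP : NoContactFreeNonPrincipalInLocusTowers) :
    ∀ n : ℕ, 1 ≤ n → ForcedTowersTerminate n :=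
  forcedTowersTerminate_of_g45 hMo hSL hH hP hM riderPortAll_holds h71 hB hC4 hD4 hNP noPurePrincipalTowers_holds
    noIncommensurableWildDriftingImperfectTowers_holds

/-- **30253 `MaxContactCut.NoForcedTowers` BY NAME from TEN binders: g45's root `noForcedTowers_of_g45` with `hRi : RiderPortAll`,
`hPu : NoPurePrincipalTowers`, `hR : NoIncommensurableWildDriftingImperfectTowers` DISCHARGED by the theorems of §2 — the other ten
binders verbatim.**  NOT a proof of `MaxContactCut.NoForcedTowers` outright: `hMo hSL hP hM` (structural), `hH h71` (hugging
columns), `hB hC4 hD4` (non-threefold mixed cells) and `hNP` (the non-principal in-locus leaf) remain hypotheses. [folklore] -/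
theorem noForcedTowers_of_g47 (hMo : MaxContactCut.MonomialCornerAll)
    (hSL : MaxContactCut.SurfaceLawAll) (hH : MaxContactCut.NoHypersurfaceHuggingTowers) (hP : ShadowPortAll)
    (hM : MarkingPortAll) (h71 : MaxContactCut.NoContactHuggingTowers)
    (hB : NoWildLatentFactorNonThreefoldMixedTowers)
    (hC4 : NoWildOccultDivisorialNonThreefoldMixedTowers) (hD4 : NoWildOccultNonDivisorialNonThreefoldMixedTowers)
    (hNP : NoContactFreeNonPrincipalInLocusTowers) :
    MaxContactCut.NoForcedTowers :=
  noForcedTowers_of_g45 hMo hSL hH hP hM riderPortAll_holds h71 hB hC4 hD4 hNP noPurePrincipalTowers_holds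
    noIncommensurableWildDriftingImperfectTowers_holds

/-- the same from the ABSOLUTE g43 located residual `NoWildOccultNonThreefoldMixedTowers` by name (nine binders). [folklore] -/
theorem noForcedTowers_of_g47_residual (hMo : MaxContactCut.MonomialCornerAll)
    (hSL : MaxContactCut.SurfaceLawAll) (hH : MaxContactCut.NoHypersurfaceHuggingTowers) (hP : ShadowPortAll)
    (hM : MarkingPortAll) (h71 : MaxContactCut.NoContactHuggingTowers)
    (hB : NoWildLatentFactorNonThreefoldMixedTowers) (hres : NoWildOccultNonThreefoldMixedTowers)
    (hNP : NoContactFreeNonPrincipalInLocusTowers) :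
    MaxContactCut.NoForcedTowers :=
  noForcedTowers_of_g47 hMo hSL hH hP hM h71 hB hres.1 hres.2 hNP

-- WRITER NOTE (g16, dedup.landed at pre-flight): `noForcedTowers_of_g45_of_g47` deleted — its statement is the landed
-- `HugValuationCut.noForcedTowers_of_g45` (Theorems/CurveBranchRoot45.lean) verbatim; cite that theorem instead.

end Root

end Summit.ResolutionOfSingularities.ResolutionOfSingularities.Theorems.HugValuationCut

end
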